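import Summits.NavierStokesRegularity.NavierStokesRegularity.Theorems.QuietScarPocketDoorDefs
import Summits.NavierStokesRegularity.NavierStokesRegularity.Theorems.QuietScarPocketDoorFrame
import Summits.NavierStokesRegularity.NavierStokesRegularity.Theorems.QuietScarPocketDoorZoomClass
import Summits.NavierStokesRegularity.NavierStokesRegularity.Theorems.QuietScarPocketDoorZoomBall
import Summits.NavierStokesRegularity.NavierStokesRegularity.Theorems.QuietScarPocketDoorZoomApexSingular
import Literature.Analysis.FluidPDE.LocalTypeIBlowup.SingularVertexZoomSeq
import Literature.Analysis.FluidPDE.ClassicalSolutionRegionRescale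
import Literature.Analysis.FluidPDE.ESSLocalHolderBlowupLimit

/-!
# QuietScarPocketDoorZoomLimit — door S31 «QuietScarPocketDoor» (nsreg-p1 g25 ROUND-29 v2.1, texts `r29/Sketch31.lean`
# 363b5766493b6c28; Defs p622283), K-piece PK1 `scarPocketZoom_holds`, file F3: THE CLASS ZOOM AT THE POCKET SCALE (LEAD)

`exists_scarPocket_classZoom` (F3 of the LEAD skeleton `HOME/ns-s30-p1/PK1-Skeleton.lean`): if the Pineau–Vicol-frame door fails
at `(C_u, κ)`, then along counterexamples `(u_k, p_k)` with pocket smallness `ε_k = 1/(k+1)`, shell levels `C_p^k`, and pocket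
centres `x₁ᵏ` with `λ_k = ‖x₁ᵏ‖ ≤ μ_k/(k+2)` (`μ_k = μ(C_u, C_p^k)` the radius of F2 on which `𝐈 ≤ I(C_u)`), the pocket-scale
zooms `w_k = λ_k u_k(λ_k² ·, λ_k ·)` — classical on `Q(0, μ_k/λ_k) ↑ (−∞,0) × ℝ³`, one-point Type I, `𝐈 ≤ I`, pocket on
`B(e_k, κ)` with `e_k = x₁ᵏ/λ_k → e` — converge in `L³(Q(0,r))` for every `r` to a Type-I ancient mild field `U` which is slab
suitable with `𝐈 < ⊤` and BACKWARD SINGULAR AT THE ORIGIN.  ENGINE: the tree's Barker–Prange/Albritton–Barker class zoom at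
prescribed singular vertices with prescribed scales, `LocalTypeIBlowup.exists_typeIAncientMild_zoomLimit_seq`, fed with the
`μ_k`-zooms (F2′ `pv_zoom_ballData`, F2″ `isBackwardSingularPoint_nsRescale_of_not_bounded` — ns-sz-p1) and the scales
`R_k = λ_k/μ_k → 0`.

Door S31 is a regularity CRITERION about a HYPOTHETICAL one-point Type-I blow-up; item 0056 `NoTypeII` and NS regularity are
NOT proved and stay OPEN.
-/

noncomputable section

set_option linter.dupNamespace false

namespace Summit.NavierStokesRegularity.NavierStokesRegularity.Theorems.QuietScarPocketDoor

open MeasureTheory Set Function Filter Topology TopologicalSpace Metric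
open scoped NNReal ENNReal Topology
open Literature.Analysis Literature.Analysis.FluidPDE

/-- unpacking the failure of the door at `(C_u, κ)`: for every `ε > 0` a shell level `C_p` such that at every pocket threshold
`r₁` some member of the class has an `ε`-quiet pocket below `r₁` and is unbounded near the apex. -/
theorem exists_counterexample_of_not_door {Cu κ : ℝ} (hdoor : ¬ PVScarPocketRegularityAt Cu κ) {ε : ℝ} (hε : 0 < ε) :
    ∃ Cp : ℝ, 0 < Cp ∧ ∀ r₁ : ℝ, 0 < r₁ →
      ∃ (u : ℝ → EuclideanSpace ℝ (Fin 3) → EuclideanSpace ℝ (Fin 3)) (p : ℝ → EuclideanSpace ℝ (Fin 3) → ℝ),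
        IsClassicalNSSolutionOnRegion (Ico (-1 : ℝ) 0 ×ˢ ball (0 : EuclideanSpace ℝ (Fin 3)) 1) 1 0 u p ∧
        (∀ t ∈ Ico (-1 : ℝ) 0, ∀ x ∈ ball (0 : EuclideanSpace ℝ (Fin 3)) 1, ‖u t x‖ ≤ Cu / (Real.sqrt (-t) + ‖x‖)) ∧
        (∀ t ∈ Ico (-1 : ℝ) 0, ∀ x : EuclideanSpace ℝ (Fin 3), 1 / 2 < ‖x‖ → ‖x‖ < 3 / 4 → |p t x| ≤ Cp) ∧
        (∃ x₁ : EuclideanSpace ℝ (Fin 3), 0 < ‖x₁‖ ∧ ‖x₁‖ ≤ r₁ ∧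
          ∀ x ∈ ball x₁ (κ * ‖x₁‖), ∀ᶠ t in 𝓝[<] (0 : ℝ), ‖x₁‖ ^ 2 * ‖curl (u t) x‖ ≤ ε) ∧
        ¬ ∃ ϱ : ℝ, 0 < ϱ ∧ ∃ B : ℝ, ∀ t : ℝ, -ϱ ^ 2 < t → t < 0 →
          ∀ x ∈ ball (0 : EuclideanSpace ℝ (Fin 3)) ϱ, ‖u t x‖ ≤ B := by
  by_contra hc
  apply hdoor
  refine ⟨ε, hε, fun Cp hCp => ?_⟩
  by_contra hc'
  apply hc
  refine ⟨Cp, hCp, fun r₁ hr₁ => ?_⟩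
  by_contra hc''
  apply hc'
  refine ⟨r₁, hr₁, fun u p hreg hI hP hpk => ?_⟩
  by_contra hbd
  exact hc'' ⟨u, p, hreg, hI, hP, hpk, hbd⟩

/-- the pocket-scale zoom `nsRescale λ u` of a member of the class is classical on `Q(0, μ/λ)` whenever `Q(0,μ)` lies in the
unit apex cylinder (`0 < μ ≤ 1`). -/
theorem isClassical_nsRescale_cylinder {u : ℝ → EuclideanSpace ℝ (Fin 3) → EuclideanSpace ℝ (Fin 3)}
    {p : ℝ → EuclideanSpace ℝ (Fin 3) → ℝ}
    (hreg : IsClassicalNSSolutionOnRegion (Ico (-1 : ℝ) 0 ×ˢ ball (0 : EuclideanSpace ℝ (Fin 3)) 1) 1 0 u p)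
    {μ lam : ℝ} (hμ : 0 < μ) (hμ1 : μ ≤ 1) (hlam : 0 < lam) :
    IsClassicalNSSolutionOnRegion (parabolicCylinder (μ / lam) (0 : ℝ × EuclideanSpace ℝ (Fin 3))) 1 0
      (nsRescale lam u) (nsRescalePressure lam p) := by
  have hO : IsOpen (Ioo (-1 : ℝ) 0 ×ˢ ball (0 : EuclideanSpace ℝ (Fin 3)) 1) := isOpen_Ioo.prod isOpen_ball
  have h1 := (hreg.mono_of_isOpen (prod_mono Ioo_subset_Ico_self Subset.rfl) hO).nsRescale_translate_of_isOpen hO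
    hlam 0 0
  rw [← nsRescale_eq_smul_stPull, ← nsRescalePressure_eq_smul_stPull_zero] at h1
  have ef : (lam ^ 2 * lam) • stPull (lam ^ 2) lam 0 (0 : EuclideanSpace ℝ (Fin 3))
      (0 : ℝ → EuclideanSpace ℝ (Fin 3) → EuclideanSpace ℝ (Fin 3)) = 0 := by
    funext s y; simp [stPull_apply]
  rw [ef] at h1
  refine h1.mono_of_isOpen ?_ (isOpen_parabolicCylinder _ 0)
  have hsub : parabolicCylinder μ (0 : ℝ × EuclideanSpace ℝ (Fin 3)) ⊆
      Ioo (-1 : ℝ) 0 ×ˢ ball (0 : EuclideanSpace ℝ (Fin 3)) 1 := by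
    intro w hw
    obtain ⟨hwt, hwx⟩ := mem_prod.1 hw
    simp only [Prod.fst_zero, zero_sub] at hwt
    have hμ2 : μ ^ 2 ≤ 1 := by nlinarith
    exact mk_mem_prod ⟨by linarith [hwt.1], hwt.2⟩ (ball_subset_ball hμ1 (by simpa using hwx))
  have hpre := zoom_preimage_parabolicCylinder hlam (0 : ℝ × EuclideanSpace ℝ (Fin 3)) μ
  simp only [Prod.fst_zero, Prod.snd_zero] at hpre
  rw [← hpre]
  exact preimage_mono hsub

/-- the one-point bound is scale-exact: the zoom `nsRescale λ u` obeys it on `Q(0, μ/λ)` (`0 < λ`, `0 < μ ≤ 1`). -/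
theorem norm_nsRescale_le_of_typeI_cylinder {u : ℝ → EuclideanSpace ℝ (Fin 3) → EuclideanSpace ℝ (Fin 3)} {Cu μ lam : ℝ}
    (hI : ∀ t ∈ Ico (-1 : ℝ) 0, ∀ x ∈ ball (0 : EuclideanSpace ℝ (Fin 3)) 1, ‖u t x‖ ≤ Cu / (Real.sqrt (-t) + ‖x‖))
    (hμ1 : μ ≤ 1) (hlam : 0 < lam) {z : ℝ × EuclideanSpace ℝ (Fin 3)}
    (hz : z ∈ parabolicCylinder (μ / lam) (0 : ℝ × EuclideanSpace ℝ (Fin 3))) :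
    ‖nsRescale lam u z.1 z.2‖ ≤ Cu / (Real.sqrt (-z.1) + ‖z.2‖) := by
  obtain ⟨ht, hx⟩ := mem_prod.1 hz
  simp only [Prod.fst_zero, zero_sub] at ht
  rw [mem_ball, Prod.snd_zero, dist_zero_right] at hx
  have hμ0 : 0 < μ := by
    have : 0 < μ / lam := by
      have h0 : (0 : ℝ) ≤ ‖z.2‖ := norm_nonneg _
      linarith
    have := mul_pos this hlam
    rwa [div_mul_cancel₀ _ hlam.ne'] at this
  have hs : 0 < -z.1 := by linarith [ht.2]
  -- the physical point
  have ht' : lam ^ 2 * z.1 ∈ Ico (-1 : ℝ) 0 := by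
    constructor
    · have h1 : -(μ / lam) ^ 2 < z.1 := ht.1
      have h2 : lam ^ 2 * (-(μ / lam) ^ 2) = -μ ^ 2 := by field_simp
      have hμ2 : μ ^ 2 ≤ 1 := by nlinarith
      nlinarith [mul_lt_mul_of_pos_left h1 (pow_pos hlam 2)]
    · nlinarith [ht.2, pow_pos hlam 2]
  have hx' : lam • z.2 ∈ ball (0 : EuclideanSpace ℝ (Fin 3)) 1 := by
    rw [mem_ball, dist_zero_right, norm_smul, Real.norm_of_nonneg hlam.le]
    calc lam * ‖z.2‖ < lam * (μ / lam) := mul_lt_mul_of_pos_left hx hlam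
      _ = μ := mul_div_cancel₀ _ hlam.ne'
      _ ≤ 1 := hμ1
  have h := hI _ ht' _ hx'
  have hCu : 0 ≤ Cu := pv_typeI_const_nonneg hI
  rw [nsRescale_apply, norm_smul, Real.norm_of_nonneg hlam.le]
  have hsq : Real.sqrt (-(lam ^ 2 * z.1)) = lam * Real.sqrt (-z.1) := by
    rw [show -(lam ^ 2 * z.1) = lam ^ 2 * (-z.1) by ring, Real.sqrt_mul (pow_nonneg hlam.le 2), Real.sqrt_sq hlam.le]
  rw [hsq, norm_smul, Real.norm_of_nonneg hlam.le, ← mul_add] at h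
  have hden : 0 < Real.sqrt (-z.1) + ‖z.2‖ := by positivity
  calc lam * ‖u (lam ^ 2 * z.1) (lam • z.2)‖ ≤ lam * (Cu / (lam * (Real.sqrt (-z.1) + ‖z.2‖))) :=
        mul_le_mul_of_nonneg_left h hlam.le
    _ = Cu / (Real.sqrt (-z.1) + ‖z.2‖) := by field_simp

/-- **F3 — THE CLASS ZOOM AT THE POCKET SCALE.** -/
theorem exists_scarPocket_classZoom {Cu κ : ℝ} (hdoor : ¬ PVScarPocketRegularityAt Cu κ) :
    ∃ (w : ℕ → ℝ → EuclideanSpace ℝ (Fin 3) → EuclideanSpace ℝ (Fin 3)) (π : ℕ → ℝ → EuclideanSpace ℝ (Fin 3) → ℝ)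
      (Rk : ℕ → ℝ) (ek : ℕ → EuclideanSpace ℝ (Fin 3)) (εk : ℕ → ℝ) (I : ℝ≥0) (e : EuclideanSpace ℝ (Fin 3))
      (U : ℝ → EuclideanSpace ℝ (Fin 3) → EuclideanSpace ℝ (Fin 3)) (P : ℝ → EuclideanSpace ℝ (Fin 3) → ℝ)
      (H : ℝ → EuclideanSpace ℝ (Fin 3) → EuclideanSpace ℝ (Fin 3) →L[ℝ] EuclideanSpace ℝ (Fin 3)),
      (∀ k, 1 ≤ Rk k) ∧ Tendsto Rk atTop atTop ∧
      (∀ k, IsClassicalNSSolutionOnRegion (parabolicCylinder (Rk k) (0 : ℝ × EuclideanSpace ℝ (Fin 3))) 1 0 (w k) (π k)) ∧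
      (∀ k, ∀ z ∈ parabolicCylinder (Rk k) (0 : ℝ × EuclideanSpace ℝ (Fin 3)),
        ‖w k z.1 z.2‖ ≤ Cu / (Real.sqrt (-z.1) + ‖z.2‖)) ∧
      (∀ k, typeIBound (parabolicCylinder (Rk k) (0 : ℝ × EuclideanSpace ℝ (Fin 3))) (w k) (π k)
        (fun t x => fderiv ℝ (w k t) x) ≤ I) ∧
      (∀ k, ‖ek k‖ = 1) ∧ Tendsto ek atTop (𝓝 e) ∧ ‖e‖ = 1 ∧
      (∀ k, 0 ≤ εk k) ∧ Tendsto εk atTop (𝓝 0) ∧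
      (∀ k, ∀ y ∈ ball (ek k) κ, ∀ᶠ s in 𝓝[<] (0 : ℝ), ‖curl (w k s) y‖ ≤ εk k) ∧
      IsTypeIAncientMild Cu U ∧
      IsSuitableWeakSolutionOn (slab (EuclideanSpace ℝ (Fin 3)) (Set.Iio (0 : ℝ)) isOpen_Iio) 1 0 U P ∧
      HasWeakSpatialGradientOn (slab (EuclideanSpace ℝ (Fin 3)) (Set.Iio (0 : ℝ)) isOpen_Iio) U H ∧
      typeIBound (Iio (0 : ℝ) ×ˢ univ) U P H < ⊤ ∧ IsBackwardSingularPoint U 0 ∧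
      (∀ r : ℝ, 0 < r → Tendsto (fun k => eLpNorm (uncurry (w k) - uncurry U) 3
          (volume.restrict (parabolicCylinder r (0 : ℝ × EuclideanSpace ℝ (Fin 3))))) atTop (𝓝 0)) := by
  classical
  -- ## the class radius of F2
  obtain ⟨I, hIall⟩ := exists_pv_typeIBound_le Cu
  -- ## the counterexamples, level by level
  have hlev : ∀ k : ℕ, ∃ (Cp μ : ℝ) (u : ℝ → EuclideanSpace ℝ (Fin 3) → EuclideanSpace ℝ (Fin 3))
      (p : ℝ → EuclideanSpace ℝ (Fin 3) → ℝ) (x₁ : EuclideanSpace ℝ (Fin 3)),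
      0 < μ ∧ μ ≤ 1 / 64 ∧
      IsClassicalNSSolutionOnRegion (Ico (-1 : ℝ) 0 ×ˢ ball (0 : EuclideanSpace ℝ (Fin 3)) 1) 1 0 u p ∧
      (∀ t ∈ Ico (-1 : ℝ) 0, ∀ x ∈ ball (0 : EuclideanSpace ℝ (Fin 3)) 1, ‖u t x‖ ≤ Cu / (Real.sqrt (-t) + ‖x‖)) ∧
      (∀ t ∈ Ico (-1 : ℝ) 0, ∀ x : EuclideanSpace ℝ (Fin 3), 1 / 2 < ‖x‖ → ‖x‖ < 3 / 4 → |p t x| ≤ Cp) ∧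
      typeIBound (parabolicCylinder μ (0 : ℝ × EuclideanSpace ℝ (Fin 3))) u p (fun t x => fderiv ℝ (u t) x) ≤ I ∧
      0 < ‖x₁‖ ∧ ‖x₁‖ ≤ μ / ((k : ℝ) + 2) ∧
      (∀ x ∈ ball x₁ (κ * ‖x₁‖), ∀ᶠ t in 𝓝[<] (0 : ℝ), ‖x₁‖ ^ 2 * ‖curl (u t) x‖ ≤ 1 / ((k : ℝ) + 1)) ∧
      ¬ ∃ ϱ : ℝ, 0 < ϱ ∧ ∃ B : ℝ, ∀ t : ℝ, -ϱ ^ 2 < t → t < 0 →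
          ∀ x ∈ ball (0 : EuclideanSpace ℝ (Fin 3)) ϱ, ‖u t x‖ ≤ B := by
    intro k
    obtain ⟨Cp, hCp, hr⟩ := exists_counterexample_of_not_door hdoor (by positivity : (0 : ℝ) < 1 / ((k : ℝ) + 1))
    obtain ⟨μ, hμ, hμ64, hμI⟩ := hIall Cp
    obtain ⟨u, p, hreg, hI, hP, ⟨x₁, hx₁, hx₁r, hpk⟩, hbd⟩ := hr (μ / ((k : ℝ) + 2)) (by positivity)
    exact ⟨Cp, μ, u, p, x₁, hμ, hμ64, hreg, hI, hP, hμI u p hreg hI hP, hx₁, hx₁r, hpk, hbd⟩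
  choose Cp μ u p x₁ hμ hμ64 hreg hI hP hIμ hx₁ hx₁μ hpk hbd using hlev
  -- ## scales
  set lam : ℕ → ℝ := fun k => ‖x₁ k‖ with hlam_def
  have hlam : ∀ k, 0 < lam k := hx₁
  have hμ1 : ∀ k, μ k ≤ 1 := fun k => (hμ64 k).trans (by norm_num)
  have hlamμ : ∀ k, lam k * ((k : ℝ) + 2) ≤ μ k := fun k => by
    have h := hx₁μ k
    rwa [le_div_iff₀ (by positivity)] at h
  -- ## directions: a convergent subsequence on the unit sphere
  set e' : ℕ → EuclideanSpace ℝ (Fin 3) := fun k => (lam k)⁻¹ • x₁ k with he'_def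
  have he'1 : ∀ k, ‖e' k‖ = 1 := fun k => by
    rw [he'_def]; dsimp only
    rw [norm_smul, norm_inv, Real.norm_of_nonneg (hlam k).le, hlam_def, inv_mul_cancel₀ (hx₁ k).ne']
  obtain ⟨e, he, φ₀, hφ₀, hφ₀e⟩ := (isCompact_sphere (0 : EuclideanSpace ℝ (Fin 3)) 1).tendsto_subseq
    (fun k => show e' k ∈ sphere (0 : EuclideanSpace ℝ (Fin 3)) 1 by rw [mem_sphere_zero_iff_norm]; exact he'1 k)
  rw [mem_sphere_zero_iff_norm] at he
  -- ## the engine's sequence: the `μ`-zooms along `φ₀`, scales `R = λ/μ`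
  set v : ℕ → ℝ → EuclideanSpace ℝ (Fin 3) → EuclideanSpace ℝ (Fin 3) := fun n => nsRescale (μ (φ₀ n)) (u (φ₀ n)) with hv_def
  set q : ℕ → ℝ → EuclideanSpace ℝ (Fin 3) → ℝ := fun n => nsRescalePressure (μ (φ₀ n)) (p (φ₀ n)) with hq_def
  set R : ℕ → ℝ := fun n => lam (φ₀ n) / μ (φ₀ n) with hR_def
  have hRpos : ∀ n, 0 < R n := fun n => div_pos (hlam _) (hμ _)
  have hRle : ∀ n, R n ≤ 1 / ((n : ℝ) + 2) := by
    intro n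
    rw [hR_def]; dsimp only
    rw [div_le_div_iff₀ (hμ _) (by positivity), one_mul]
    have hn : ((n : ℝ) + 2) ≤ ((φ₀ n : ℕ) : ℝ) + 2 := by
      have := hφ₀.id_le n; exact_mod_cast Nat.add_le_add_right this 2
    calc lam (φ₀ n) * ((n : ℝ) + 2) ≤ lam (φ₀ n) * (((φ₀ n : ℕ) : ℝ) + 2) :=
          mul_le_mul_of_nonneg_left hn (hlam _).le
      _ ≤ μ (φ₀ n) := hlamμ _
  have hR0 : Tendsto R atTop (𝓝 0) := by
    have h2 : Tendsto (fun n : ℕ => 1 / ((n : ℝ) + 2)) atTop (𝓝 0) := by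
      have h := tendsto_one_div_add_atTop_nhds_zero_nat (𝕜 := ℝ)
      have h' : Tendsto (fun n : ℕ => n + 1) atTop atTop := tendsto_add_atTop_nat 1
      have := h.comp h'
      refine this.congr fun n => ?_
      simp only [Function.comp, Nat.cast_add, Nat.cast_one]
      ring_nf
    exact squeeze_zero (fun n => (hRpos n).le) hRle h2
  have hdata := fun n => pv_zoom_ballData (hreg (φ₀ n)) (hI (φ₀ n)) (hP (φ₀ n)) (hμ (φ₀ n)) (hμ64 (φ₀ n)) (hIμ (φ₀ n))
  have hcontu : ∀ k, ContinuousOn (uncurry (u k)) (Ioo (-1 : ℝ) 0 ×ˢ ball (0 : EuclideanSpace ℝ (Fin 3)) 1) := fun k =>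
    (hreg k).smooth_velocity.continuousOn.mono (prod_mono Ioo_subset_Ico_self Subset.rfl)
  obtain ⟨φ, hφ, U, P, H, hmild, hsw, hwg, hIU, hsing, hL3, -, -⟩ :=
    LocalTypeIBlowup.exists_typeIAncientMild_zoomLimit_seq (u := v) (p := q)
      (G := fun n t x => fderiv ℝ (v n t) x) (z₀ := fun _ => (0 : ℝ × EuclideanSpace ℝ (Fin 3))) (M := Cu)
      one_pos (I := (I : ℝ≥0∞)) ENNReal.coe_lt_top
      (fun n => (hdata n).1) (fun n => (hdata n).2.1) (fun n => (hdata n).2.2.1) (fun n => (hdata n).2.2.2.1)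
      (fun n t x htx => (hdata n).2.2.2.2 t x htx)
      (fun n => isBackwardSingularPoint_nsRescale_of_not_bounded (hμ (φ₀ n)) (hcontu (φ₀ n)) (hbd (φ₀ n)))
      hRpos hR0
  -- ## the outputs along `k_j = φ₀ (φ j)`
  set kk : ℕ → ℕ := fun j => φ₀ (φ j) with hkk_def
  have hkk : StrictMono kk := hφ₀.comp hφ
  set L : ℕ → ℝ := fun j => lam (kk j) with hL_def
  have hL : ∀ j, 0 < L j := fun j => hlam _
  -- identification of the engine's zoom with the pocket-scale zoom
  have hRL : ∀ j, R (φ j) * μ (kk j) = L j := fun j => div_mul_cancel₀ _ (hμ _).ne'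
  have hzoom : ∀ j, R (φ j) • stPull (R (φ j) ^ 2) (R (φ j)) ((fun _ : ℕ => (0 : ℝ × EuclideanSpace ℝ (Fin 3))) (φ j)).1
      ((fun _ : ℕ => (0 : ℝ × EuclideanSpace ℝ (Fin 3))) (φ j)).2 (v (φ j)) = nsRescale (L j) (u (kk j)) := by
    intro j
    simp only [Prod.fst_zero, Prod.snd_zero]
    rw [hv_def]; dsimp only
    rw [nsRescale_eq_smul_stPull, nsRescale_eq_smul_stPull, zoom_zoom, hRL]
  refine ⟨fun j => nsRescale (L j) (u (kk j)), fun j => nsRescalePressure (L j) (p (kk j)), fun j => μ (kk j) / L j,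
    fun j => (L j)⁻¹ • x₁ (kk j), fun j => 1 / (((kk j : ℕ) : ℝ) + 1), I, e, U, P, H, ?_, ?_, ?_, ?_, ?_, ?_, ?_, he, ?_, ?_,
    ?_, hmild, hsw, hwg, hIU, hsing, ?_⟩
  · -- `1 ≤ μ/λ`
    intro j
    dsimp only
    rw [le_div_iff₀ (hL j), one_mul]
    have h := hlamμ (kk j)
    have hk0 : (0 : ℝ) ≤ ((kk j : ℕ) : ℝ) := Nat.cast_nonneg _
    have hLj : L j = lam (kk j) := rfl
    rw [hLj]
    nlinarith [hlam (kk j)]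
  · -- `μ/λ → ∞`
    have h1 : Tendsto (fun j => ((kk j : ℕ) : ℝ) + 2) atTop atTop :=
      tendsto_atTop_add_const_right _ _ (tendsto_natCast_atTop_atTop.comp hkk.tendsto_atTop)
    refine tendsto_atTop_mono (fun j => ?_) h1
    rw [le_div_iff₀ (hL j)]
    have h := hlamμ (kk j)
    have hLj : L j = lam (kk j) := rfl
    rw [hLj, mul_comm]
    exact h
  · intro j
    dsimp only
    exact isClassical_nsRescale_cylinder (hreg _) (hμ _) (hμ1 _) (hL j)
  · intro j z hz
    dsimp only at hz ⊢
    exact norm_nsRescale_le_of_typeI_cylinder (hI _) (hμ1 _) (hL j) hz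
  · -- transport of `𝐈`
    intro j
    dsimp only
    have h := typeIBound_nsZoom (hL j) (0 : ℝ × EuclideanSpace ℝ (Fin 3)).1 (0 : ℝ × EuclideanSpace ℝ (Fin 3)).2
      (parabolicCylinder (μ (kk j)) (0 : ℝ × EuclideanSpace ℝ (Fin 3))) (u (kk j)) (p (kk j))
      (fun t x => fderiv ℝ (u (kk j) t) x)
    rw [zoom_preimage_parabolicCylinder (hL j)] at h
    simp only [Prod.fst_zero, Prod.snd_zero] at h
    rw [fderiv_nsRescale_eq_smul_stPull, nsRescale_eq_smul_stPull, nsRescalePressure_eq_smul_stPull_zero, h]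
    exact hIμ _
  · intro j
    dsimp only
    rw [norm_smul, norm_inv, Real.norm_of_nonneg (hL j).le]
    exact inv_mul_cancel₀ (hL j).ne'
  · exact hφ₀e.comp hφ.tendsto_atTop
  · intro j
    dsimp only
    positivity
  · have h := tendsto_one_div_add_atTop_nhds_zero_nat (𝕜 := ℝ)
    exact h.comp hkk.tendsto_atTop
  · -- the pocket at the zoomed scale
    intro j y hy
    dsimp only at hy ⊢
    have hxmem : L j • y ∈ ball (x₁ (kk j)) (κ * ‖x₁ (kk j)‖) := by
      rw [mem_ball, dist_eq_norm]
      have : L j • y - x₁ (kk j) = L j • (y - (L j)⁻¹ • x₁ (kk j)) := by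
        rw [smul_sub, smul_inv_smul₀ (hL j).ne']
      rw [this, norm_smul, Real.norm_of_nonneg (hL j).le]
      rw [mem_ball, dist_eq_norm] at hy
      have := mul_lt_mul_of_pos_left hy (hL j)
      simpa [hL_def, hlam_def, mul_comm] using this
    have hev := hpk (kk j) (L j • y) hxmem
    have hT : Tendsto (fun s : ℝ => (0 : ℝ) + L j ^ 2 * s) (𝓝[<] (0 : ℝ)) (𝓝[<] (0 : ℝ)) :=
      tendsto_time_affine_nhdsLT (pow_pos (hL j) 2)
    filter_upwards [hT.eventually hev] with s hs
    rw [nsRescale_eq_smul_stPull, curl_smul_stPull, norm_smul, Real.norm_of_nonneg (by positivity), zero_add,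
      show L j * L j = ‖x₁ (kk j)‖ ^ 2 by rw [hL_def, hlam_def]; ring]
    simpa only [zero_add] using hs
  · intro r hr
    have h := hL3 r hr
    simp only [hzoom] at h
    dsimp only
    exact h

end Summit.NavierStokesRegularity.NavierStokesRegularity.Theorems.QuietScarPocketDoor

end
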